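import Summits.QuantumFields.BalabanUV.Beta.GAN24.AxProjBmWindow
import Summits.QuantumFields.BalabanUV.Beta.GAN24.RespStepBmGauge
import Summits.QuantumFields.BalabanUV.Beta.GAN24.RespStepSemigroup

/-!
# `BalabanUV.Beta.GAN24.RespStepBmGaugeStep` — binder row G-an2-4 / (CONV-C), S-slot on the literal of record (family (E), road «SREC», row V4-b):
# ONE DRESSED STEP ON AN EXACT DATUM — `Π^ρ_bm (𝒬_M ℋ_{N′} (d_c ψ)) = dz ψ′` with `ψ′` BLOCK-CONSTANT on the `L`-blocks (summable `ψ`),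
# in operator form, in `respStep`-leg form, and for the dressed one-step leg `colH (coDressKBmAt ρ Lc K̃_m) Lc` of the (E) recursion in units

NOT IN PRINT; OUR BOOKKEEPING (idle-seat piece «SREC-GAUGESTEP» = RULINGS-15b (R15-5) of the row owner `b2b-balaban-gan24-p1` gen 12, journal l.17754;
row V4-b `RespStepBmGaugeStep` of `HOME/b2b-balaban-gan24-p1/PARTV-SREC-ROWS.md`; SKELETON-SREC v0.2 SR-L4a; part 2 of 2 after `GAN24/AxProjBmWindow`).
HONEST FRAMING (cell contract, verbatim): «discharging `BetaPertH` makes Bałaban's UV stability UNCONDITIONAL — a real constructive-QFT result; it is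
NOT the continuum limit and NOT the Clay problem.»  HONEST DEPENDENCY (verbatim): «continuum YM on T⁴ ⇐ BetaPertH ∧ nine spine estimates (0/9 proved);
BetaPertH ⇐ (D1) ∧ (D4) ∧ CAP+tail; G-an2-4 gates asym, D1 and NE2/3/4.»  [folklore] assembly of tree theorems BY NAME — gen-12's `RespStepBmGauge`
(`curv_exactResponse_tsum_eq_zero`, `exists_dz_eq_exactResponse`, `summable_exactResponse_term`), an5's `ResolventComposition` (`Hcol`, `HcolSum`, `Tex`, `cex`,
`sum_Tex`, `Hcol_bdd_summable`, `exists_dz_eq_of_curv_eq_zero`, `contourSum_tsum` ∕ `_finset_sum` ∕ `_const_mul`), the lead's `AffineAveraging.contourSum_dz`,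
an2's `BalabanCompositeJets.respStep` and `BorderedHessian.axProjBmAt_dz` ∕ `AxialProjectorBlockMean.blockMeanAt_blockConst`, leaf-12's
`RespStepSemigroup.colH_KStepUnit`, part 1's `AxProjBmWindow.axProjBmAt_eq_coProjBmW`; generic dimension; NO estimate, NO cited fact, NO `def`, NO `def … : Prop`,
NO wall binder; reserved families (`RespStepBmDecomp`, `RespStepBmDecay*`, `SrecUnitSplit*`, `SrecCharge*`, `StencilSlotSrec*`) untouched, NO `respStepBm`
definition (row V1-d's).  Discharges NOTHING of (hS, hSall) on (E); NOT D1, NOT BetaPertH, NOT continuum, NOT Clay.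

## Why (SKELETON-SREC v0.2 SR-L4a, locator — not a premise)
SR-L4a's induction on `n − m` for `T_{m→n} = Π_m ∘ respStep (Lc^m)(Lc^n) + dz ∘ Ψ_{m,n}` feeds, at each level, an inter-block pure gauge `dz ψ` (created by
`Π_{m+1}`) into the next dressed leg `T_m = Π_m ∘ 𝒬_{Lc^m} ℋ_{Lc^{m+1}}`.  THIS file is that step: the response `ℋ_{N′}(d_c ψ)` is flat hence exact (gen 12, one
level down), `𝒬_M` of an exact fine form is the coarse gradient of the block sum (`contourSum_dz`), and `Π_bm` of a gradient is the gradient of a block-constant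
function (`axProjBmAt_dz`) — assembled in the three currencies the induction meets.

## Contents ([folklore])
§3 `contourSum_HcolSum_eq_sum_respStep`, `contourSum_exactResponse_tsum_eq` (the contour-summed elementary responses ARE `respStep` legs), `summable_mul_Hcol`,
   **`response_dz_eq_tsum_exactResponse`** (`Σ_μ Σ'_z (dz ψ)(μ,z) • ℋ_{N′}(·; μ, z) = Σ'_{y₀} ψ y₀ • ℋ_{N′}(−d_c δ_{y₀})`, summable `ψ`: an5's `sum_Tex` + one shift per direction).
§4 `exists_contourSum_exactResponse_eq_dz` ∕ `_tsum_eq_dz` (`𝒬_M (response) = dz (blockSum M g)`), **`axProjBmAt_contourSum_exactResponse`** (finite weights) ∕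
   **`axProjBmAt_contourSum_exactResponse_tsum`** (summable weights): `∃ ψ′, (∀ x, ψ′ x = ψ′ (L • blk L x)) ∧ Π^ρ_bm (𝒬_M (Σ'_{y₀} φ y₀ • ℋ_{N′}(−d_c δ_{y₀}))) = dz ψ′`
   (ANY root offset); `exists_abs_respStep_le`, `sum_tsum_mul_respStep_eq_contourSum`, `sum_tsum_dz_mul_respStep_eq`, `sum_tsum_mul_coProjBmW` (window sums out of
   the series), **`dressedStep_exact`** (LEG FORM, in-block root): `(l″,w′) ↦ Σ_μ Σ'_z (dz ψ)(μ,z) · coProjBmW ρ L (respStep M N′ μ z) (l″,w′) = dz ψ′`.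
§5 THE INSTANCE OF RECORD (`L = Lc`, `M = Lc^m`, `N′ = Lc^(m+1)`): `colH_coDressKBmAt_KStepUnit` (`colH (coDressKBmAt ρ Lc K̃_m) Lc μ z = coProjBmW ρ Lc (respStep …  μ z)`),
   `colH_coDressKBmAt_KStepUnit_eq_axProjBmAt` (`= Π^ρ_bm (respStep … μ z)` — SKELETON 1.2's `T_m` as a kernel identity), **`dressedLeg_KStepUnit_exact`**
   (the dressed one-step leg of (E) in units maps `d_c ψ`, summable `ψ`, to `dz ψ′` with `ψ′` `Lc`-block-constant).
Unit `b2b-balaban-gan24-p4` (road P4 seat in custody, gen 27, taking the row owner's idle-seat invitation), 2026-08-20.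
-/

noncomputable section

open Finset
open scoped BigOperators
open Literature.MathematicalPhysics.QuantumFieldTheory
open Literature.MathematicalPhysics.QuantumFieldTheory.Balaban1983to89
open Literature.MathematicalPhysics.QuantumFieldTheory.Balaban1983to89.Beta
open AffineAveraging (Form0 Form1 Site box toSite unitVec unitVec_apply curv dz blockSum contourSum contourSum_dz)
open AveragingContours (blk)
open ResolventComposition (Hcol HcolSum Tex cex sum_Tex Hcol_bdd_summable exists_dz_eq_of_curv_eq_zero contourSum_tsum
  contourSum_finset_sum contourSum_const_mul)
open BalabanCompositeJets (respStep)
open OneStepKernelFamily (colH)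
open Summit.QuantumFields.BalabanUV.Beta.AxialProjectorBlockMean (blockMeanAt axProjBmAt blockMeanAt_blockConst)
open Summit.QuantumFields.BalabanUV.Beta.AxialDressingRooted (pmBm cube coProjBmW coProjBmW_apply coDressKBmAt colH_coDressKBmAt_eq)
open Summit.QuantumFields.BalabanUV.Beta.BorderedHessian (axProjBmAt_dz)
open Summit.QuantumFields.BalabanUV.Beta.GAN24.RespStepBmGauge (curv_exactResponse_tsum_eq_zero summable_exactResponse_term)
open Summit.QuantumFields.BalabanUV.Beta.GAN24.CombesThomas (KStepUnit)
open Summit.QuantumFields.BalabanUV.Beta.GAN24.RespStepSemigroup (colH_KStepUnit)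
open Summit.QuantumFields.BalabanUV.Beta.GAN24.AxProjBmWindow (axProjBmAt_eq_coProjBmW axProjBmAt_eq_coProjBmW')

namespace Summit.QuantumFields.BalabanUV.Beta.GAN24.RespStepBmGaugeStep

variable {d : ℕ}

/-! ## §3 The minimiser response to an exact coarse datum, read through an2's `respStep` legs -/

section Response

variable {N' : ℕ} [NeZero N']

/-- [folklore] **THE CONTOUR-SUMMED ELEMENTARY RESPONSES ARE `respStep` LEGS**: `𝒬_M (Σ_{t ∈ T} c_t ℋ_{N′}(·; t)) (l″, w′) = Σ_{t ∈ T} c_t · respStep M N′ t.1 t.2 l″ w′`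
(`respStep M N′ μ z := 𝒬_M ℋ_{N′}(·; μ, z)` by definition; linearity of the finite contour sum). -/
theorem contourSum_HcolSum_eq_sum_respStep (M : ℕ) (T : Finset (Fin (d + 1) × Site (d + 1))) (c : Fin (d + 1) × Site (d + 1) → ℝ)
    (l'' : Fin (d + 1)) (w' : Site (d + 1)) :
    contourSum M (HcolSum (N := N') T c) l'' w' = ∑ t ∈ T, c t * respStep (d := d) M N' t.1 t.2 l'' w' := by
  rw [show HcolSum (N := N') T c = fun κ x => ∑ t ∈ T, (fun κ' x' => c t * Hcol (N := N') t.1 t.2 κ' x') κ x from rfl,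
    contourSum_finset_sum]
  refine Finset.sum_congr rfl fun t _ => ?_
  rw [contourSum_const_mul]
  rfl

/-- [folklore] The same for a SUMMABLY weighted series of elementary exact responses (the contour sum is a finite sum of evaluations; gen-12's
`summable_exactResponse_term`): `𝒬_M (Σ'_{y₀} φ y₀ • ℋ_{N′}(−d_c δ_{y₀})) (l″, w′) = Σ'_{y₀} φ y₀ · Σ_{t ∈ Tex y₀} cex y₀ t · respStep M N′ t.1 t.2 l″ w′`. -/
theorem contourSum_exactResponse_tsum_eq (M : ℕ) {φ : Site (d + 1) → ℝ} (hφ : Summable φ) (l'' : Fin (d + 1)) (w' : Site (d + 1)) :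
    contourSum M (fun κ x => ∑' y₀, φ y₀ * HcolSum (N := N') (Tex y₀) (cex y₀) κ x) l'' w'
      = ∑' y₀, φ y₀ * ∑ t ∈ Tex y₀, cex y₀ t * respStep (d := d) M N' t.1 t.2 l'' w' := by
  rw [contourSum_tsum (fun y₀ κ x => φ y₀ * HcolSum (N := N') (Tex y₀) (cex y₀) κ x) (fun κ x => summable_exactResponse_term hφ κ x)]
  refine tsum_congr fun y₀ => ?_
  rw [contourSum_const_mul, contourSum_HcolSum_eq_sum_respStep]

/-- [folklore] Summability of `z ↦ ψ z · ℋ_{N′}(·; μ, z)(κ, x)` for summable `ψ` (an5's uniform bound `Hcol_bdd_summable`). -/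
theorem summable_mul_Hcol {ψ : Site (d + 1) → ℝ} (hψ : Summable ψ) (μ : Fin (d + 1)) (κ : Fin (d + 1)) (x : Site (d + 1)) :
    Summable fun z => ψ z * Hcol (N := N') μ z κ x := by
  obtain ⟨C, _, hb, _⟩ := Hcol_bdd_summable (N := N') (d := d)
  exact KKTFluctuationEnergy.summable_mul_of_bdd' hψ fun z => hb μ z κ x

/-- [folklore] **THE RESPONSE TO A COARSE PURE GAUGE `d_c ψ` IS THE `ψ`-WEIGHTED SERIES OF ELEMENTARY EXACT RESPONSES** (summable `ψ`):
`Σ_μ Σ'_z (dz ψ)(μ, z) · ℋ_{N′}(·; μ, z) = Σ'_{y₀} ψ y₀ • ℋ_{N′}(−d_c δ_{y₀})` — an5's `sum_Tex` (`cex y₀ = −d_c δ_{y₀}`: `+1` on `(l, y₀ − e_l)`, `−1` on `(l, y₀)`)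
and one shift `y₀ = z + e_l` of the summation variable per direction. -/
theorem response_dz_eq_tsum_exactResponse {ψ : Site (d + 1) → ℝ} (hψ : Summable ψ) (κ : Fin (d + 1)) (x : Site (d + 1)) :
    ∑ μ, ∑' z, dz ψ μ z * Hcol (N := N') μ z κ x = ∑' y₀, ψ y₀ * HcolSum (N := N') (Tex y₀) (cex y₀) κ x := by
  -- right side: `HcolSum (Tex y₀) (cex y₀) κ x = Σ_l (Hcol l (y₀ − e_l) κ x − Hcol l y₀ κ x)`
  have hT : ∀ y₀, HcolSum (N := N') (Tex y₀) (cex y₀) κ x = ∑ l, (Hcol (N := N') l (y₀ - unitVec l) κ x - Hcol (N := N') l y₀ κ x) := by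
    intro y₀
    unfold HcolSum
    exact sum_Tex y₀ (fun t => Hcol (N := N') t.1 t.2 κ x)
  simp only [hT, Finset.mul_sum, mul_sub]
  have hs1 : ∀ l : Fin (d + 1), Summable fun y₀ => ψ y₀ * Hcol (N := N') l (y₀ - unitVec l) κ x := by
    intro l
    have h := (Equiv.subRight (unitVec l)).summable_iff.2 (summable_mul_Hcol (N' := N') ((Equiv.addRight (unitVec l)).summable_iff.2 hψ) l κ x)
    refine h.congr fun y₀ => ?_
    simp [Equiv.subRight, Equiv.addRight, sub_add_cancel]
  have hs2 : ∀ l : Fin (d + 1), Summable fun y₀ => ψ y₀ * Hcol (N := N') l y₀ κ x := fun l => summable_mul_Hcol hψ l κ x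
  rw [Summable.tsum_finsetSum (fun l _ => (hs1 l).sub (hs2 l))]
  refine Finset.sum_congr rfl fun l _ => ?_
  rw [(hs1 l).tsum_sub (hs2 l)]
  -- shift `y₀ = z + e_l` in the first series
  have shift : ∑' y₀, ψ y₀ * Hcol (N := N') l (y₀ - unitVec l) κ x = ∑' z, ψ (z + unitVec l) * Hcol (N := N') l z κ x := by
    rw [← (Equiv.addRight (unitVec l)).tsum_eq]
    refine tsum_congr fun z => ?_
    simp [Equiv.addRight, add_sub_cancel_right]
  rw [shift, ← Summable.tsum_sub]
  · refine tsum_congr fun z => ?_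
    simp only [dz]
    ring
  · exact summable_mul_Hcol (N' := N') ((Equiv.addRight (unitVec l)).summable_iff.2 hψ) l κ x
  · exact hs2 l

end Response

/-! ## §4 ONE DRESSED STEP ON AN EXACT DATUM: `Π^ρ_bm (𝒬_M ℋ_{N′} (d_c ψ)) = dz ψ′` with `ψ′` BLOCK-CONSTANT -/

section Step

variable {N' : ℕ} [NeZero N']

/-- [folklore] **`𝒬_M` OF THE RESPONSE TO A FINITE EXACT DATUM IS A COARSE GRADIENT**: with `g` a potential of the (flat) response (gen-12's
`exists_dz_eq_exactResponse`), `𝒬_M (response) = dz (blockSum M g)` (the lead's `contourSum_dz`: averaging intertwines the exterior derivative). -/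
theorem exists_contourSum_exactResponse_eq_dz (M : ℕ) (S : Finset (Site (d + 1))) (φ : Site (d + 1) → ℝ) :
    ∃ g : Form0 (d + 1) ℝ, contourSum M (fun κ x => ∑ y₀ ∈ S, φ y₀ * HcolSum (N := N') (Tex y₀) (cex y₀) κ x) = dz (blockSum M g) := by
  obtain ⟨g, hg⟩ := RespStepBmGauge.exists_dz_eq_exactResponse (N := N') S φ
  exact ⟨g, by rw [← hg, contourSum_dz]⟩

/-- [folklore] The same for SUMMABLE weights (gen-12's `curv_exactResponse_tsum_eq_zero` + the lattice Poincaré lemma). -/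
theorem exists_contourSum_exactResponse_tsum_eq_dz (M : ℕ) {φ : Site (d + 1) → ℝ} (hφ : Summable φ) :
    ∃ g : Form0 (d + 1) ℝ, contourSum M (fun κ x => ∑' y₀, φ y₀ * HcolSum (N := N') (Tex y₀) (cex y₀) κ x) = dz (blockSum M g) := by
  obtain ⟨g, hg⟩ := exists_dz_eq_of_curv_eq_zero (curv_exactResponse_tsum_eq_zero (N := N') hφ)
  exact ⟨g, by rw [← hg, contourSum_dz]⟩

/-- [folklore] **ONE DRESSED STEP ON A FINITE EXACT DATUM (operator form; any root offset, dressing blocking `L ≥ 1`, read-out blocking `M`)**: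
`∃ ψ` BLOCK-CONSTANT on the `L`-blocks with `Π^ρ_bm (𝒬_M (Σ_{y₀ ∈ S} φ y₀ • ℋ_{N′}(−d_c δ_{y₀}))) = dz ψ` (`ψ = blockMeanAt L (blockSum M g)`; an2's `axProjBmAt_dz`). -/
theorem axProjBmAt_contourSum_exactResponse (ρ : Fin (d + 1) → ℤ) {L : ℕ} (hL : 1 ≤ L) (M : ℕ) (S : Finset (Site (d + 1)))
    (φ : Site (d + 1) → ℝ) :
    ∃ ψ : Form0 (d + 1) ℝ, (∀ x, ψ x = ψ ((L : ℤ) • blk L x)) ∧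
      axProjBmAt ρ L (contourSum M (fun κ x => ∑ y₀ ∈ S, φ y₀ * HcolSum (N := N') (Tex y₀) (cex y₀) κ x)) = dz ψ := by
  obtain ⟨g, hg⟩ := exists_contourSum_exactResponse_eq_dz (N' := N') M S φ
  exact ⟨blockMeanAt L (blockSum M g), fun x => blockMeanAt_blockConst L _ rfl hL x, by rw [hg, axProjBmAt_dz ρ hL]⟩

/-- [folklore] **ONE DRESSED STEP ON AN EXACT DATUM, SUMMABLE WEIGHTS (operator form)** — the shape row SR-L4a's induction consumes:
`∃ ψ` BLOCK-CONSTANT on the `L`-blocks with `Π^ρ_bm (𝒬_M (Σ'_{y₀} φ y₀ • ℋ_{N′}(−d_c δ_{y₀}))) = dz ψ`. -/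
theorem axProjBmAt_contourSum_exactResponse_tsum (ρ : Fin (d + 1) → ℤ) {L : ℕ} (hL : 1 ≤ L) (M : ℕ) {φ : Site (d + 1) → ℝ}
    (hφ : Summable φ) :
    ∃ ψ : Form0 (d + 1) ℝ, (∀ x, ψ x = ψ ((L : ℤ) • blk L x)) ∧
      axProjBmAt ρ L (contourSum M (fun κ x => ∑' y₀, φ y₀ * HcolSum (N := N') (Tex y₀) (cex y₀) κ x)) = dz ψ := by
  obtain ⟨g, hg⟩ := exists_contourSum_exactResponse_tsum_eq_dz (N' := N') M hφ
  exact ⟨blockMeanAt L (blockSum M g), fun x => blockMeanAt_blockConst L _ rfl hL x, by rw [hg, axProjBmAt_dz ρ hL]⟩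

/-- [folklore] The `respStep` legs are bounded UNIFORMLY in all four arguments (finite contour sums of an5's uniformly bounded minimiser columns;
no decay is claimed here — that is `RespStepDecay`'s business). -/
theorem exists_abs_respStep_le (M : ℕ) :
    ∃ C : ℝ, ∀ (μ : Fin (d + 1)) (z : Site (d + 1)) (l'' : Fin (d + 1)) (w' : Site (d + 1)), |respStep (d := d) M N' μ z l'' w'| ≤ C := by
  obtain ⟨C, hC, hb, _⟩ := Hcol_bdd_summable (N := N') (d := d)
  refine ⟨(box (d + 1) M).card * (M * C), fun μ z l'' w' => ?_⟩
  unfold respStep contourSum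
  refine (Finset.abs_sum_le_sum_abs _ _).trans ?_
  refine (Finset.sum_le_sum fun b _ => (Finset.abs_sum_le_sum_abs _ _).trans
    (Finset.sum_le_sum fun s _ => hb μ z l'' _)).trans ?_
  simp only [Finset.sum_const, Finset.card_range, nsmul_eq_mul]
  exact le_rfl

/-- [folklore] **THE `respStep` LEGS ACT ON A SUMMABLE COARSE DATUM AS `𝒬_M` OF THE MINIMISER RESPONSE**:
`Σ_μ Σ'_z b μ z · respStep M N′ μ z l″ w′ = 𝒬_M (Σ_μ Σ'_z b μ z • ℋ_{N′}(·; μ, z)) (l″, w′)` (the contour sum is a finite sum of evaluations). -/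
theorem sum_tsum_mul_respStep_eq_contourSum {b : Form1 (d + 1) ℝ} (hb : ∀ μ, Summable (b μ)) (M : ℕ) (l'' : Fin (d + 1))
    (w' : Site (d + 1)) :
    ∑ μ, ∑' z, b μ z * respStep (d := d) M N' μ z l'' w'
      = contourSum M (fun κ x => ∑ μ, ∑' z, b μ z * Hcol (N := N') μ z κ x) l'' w' := by
  rw [show (fun κ x => ∑ μ, ∑' z, b μ z * Hcol (N := N') μ z κ x)
      = fun κ x => ∑ μ ∈ Finset.univ, (fun κ' x' => ∑' z, b μ z * Hcol (N := N') μ z κ' x') κ x from rfl, contourSum_finset_sum]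
  refine Finset.sum_congr rfl fun μ _ => ?_
  rw [contourSum_tsum (fun z κ x => b μ z * Hcol (N := N') μ z κ x) (fun κ x => summable_mul_Hcol (hb μ) μ κ x)]
  refine tsum_congr fun z => ?_
  rw [contourSum_const_mul]
  rfl

/-- [folklore] **… AND ON AN EXACT DATUM `d_c ψ` THEY RETURN `𝒬_M` OF THE `ψ`-WEIGHTED SERIES OF ELEMENTARY EXACT RESPONSES** (summable `ψ`; §3). -/
theorem sum_tsum_dz_mul_respStep_eq {ψ : Site (d + 1) → ℝ} (hψ : Summable ψ) (M : ℕ) (l'' : Fin (d + 1)) (w' : Site (d + 1)) :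
    ∑ μ, ∑' z, dz ψ μ z * respStep (d := d) M N' μ z l'' w'
      = contourSum M (fun κ x => ∑' y₀, ψ y₀ * HcolSum (N := N') (Tex y₀) (cex y₀) κ x) l'' w' := by
  rw [sum_tsum_mul_respStep_eq_contourSum (fun μ => KKTFluctuationEnergy.summable_dz hψ μ)]
  congr 1
  funext κ x
  exact response_dz_eq_tsum_exactResponse hψ κ x

omit [NeZero N'] in
/-- [folklore] **THE WINDOW OPERATOR PASSES THROUGH A SUPERPOSITION OF BOUNDED LEGS WITH SUMMABLE COEFFICIENTS**:
`Σ_μ Σ'_z b μ z · coProjBmW ρ L (R μ z) (l″, w′) = coProjBmW ρ L (Σ_μ Σ'_z b μ z • R μ z) (l″, w′)` (finite window sums out of the series). -/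
theorem sum_tsum_mul_coProjBmW (ρ : Fin (d + 1) → ℤ) (L : ℕ) {b : Form1 (d + 1) ℝ} (hb : ∀ μ, Summable (b μ))
    {R : Fin (d + 1) → Site (d + 1) → Form1 (d + 1) ℝ} {C : ℝ} (hR : ∀ μ z κ u, |R μ z κ u| ≤ C) (l'' : Fin (d + 1))
    (w' : Site (d + 1)) :
    ∑ μ, ∑' z, b μ z * coProjBmW ρ L (R μ z) l'' w' = coProjBmW ρ L (fun κ u => ∑ μ, ∑' z, b μ z * R μ z κ u) l'' w' := by
  simp only [coProjBmW_apply, Finset.mul_sum]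
  -- summability of each `(v, κ)`-piece
  have hs : ∀ (μ : Fin (d + 1)) (v : Site (d + 1)) (κ : Fin (d + 1)),
      Summable fun z => b μ z * (pmBm ρ L l'' w' κ (w' - v) * R μ z κ (w' - v)) := by
    intro μ v κ
    refine KKTFluctuationEnergy.summable_mul_of_bdd' (hb μ) (M := |pmBm ρ L l'' w' κ (w' - v)| * C) fun z => ?_
    rw [abs_mul]
    exact mul_le_mul_of_nonneg_left (hR μ z κ (w' - v)) (abs_nonneg _)
  have eL : ∀ μ : Fin (d + 1), (∑' z, ∑ v ∈ cube (d + 1) L, ∑ κ : Fin (d + 1), b μ z * (pmBm ρ L l'' w' κ (w' - v) * R μ z κ (w' - v)))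
      = ∑ v ∈ cube (d + 1) L, ∑ κ : Fin (d + 1), pmBm ρ L l'' w' κ (w' - v) * ∑' z, b μ z * R μ z κ (w' - v) := by
    intro μ
    rw [Summable.tsum_finsetSum (fun v _ => summable_sum fun κ _ => hs μ v κ)]
    refine Finset.sum_congr rfl fun v _ => ?_
    rw [Summable.tsum_finsetSum (fun κ _ => hs μ v κ)]
    refine Finset.sum_congr rfl fun κ _ => ?_
    rw [← tsum_mul_left]
    refine tsum_congr fun z => ?_
    ring
  rw [Finset.sum_congr rfl fun μ _ => eL μ, Finset.sum_comm]
  refine Finset.sum_congr rfl fun v _ => ?_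
  rw [Finset.sum_comm]

/-- [folklore] **ONE DRESSED STEP ON AN EXACT DATUM (LEG FORM; in-block root `ρ = toSite r`, dressing blocking `L ≥ 1`, read-out blocking `M`, summable `ψ`)**:
the dressed one-step legs `coProjBmW ρ L (respStep M N′ μ z)` map the exact coarse datum `d_c ψ` to an INTER-BLOCK PURE GAUGE —
`∃ ψ′` BLOCK-CONSTANT on the `L`-blocks with `(l″, w′) ↦ Σ_μ Σ'_z (dz ψ)(μ, z) · coProjBmW ρ L (respStep M N′ μ z) (l″, w′) = dz ψ′`
(§2 `Π_bm` = its window matrix, §3–§4). -/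
theorem dressedStep_exact {L : ℕ} (hL : 1 ≤ L) {r : Fin (d + 1) → ℕ} (hr : r ∈ box (d + 1) L) (M : ℕ) {ψ : Site (d + 1) → ℝ}
    (hψ : Summable ψ) :
    ∃ ψ' : Form0 (d + 1) ℝ, (∀ x, ψ' x = ψ' ((L : ℤ) • blk L x)) ∧
      (fun l'' w' => ∑ μ, ∑' z, dz ψ μ z * coProjBmW (toSite r) L (respStep (d := d) M N' μ z) l'' w') = dz ψ' := by
  obtain ⟨C, hC⟩ := exists_abs_respStep_le (N' := N') (d := d) M
  obtain ⟨ψ', hψ', h⟩ := axProjBmAt_contourSum_exactResponse_tsum (N' := N') (toSite r) hL M hψ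
  refine ⟨ψ', hψ', ?_⟩
  have e : (fun l'' w' => ∑ μ, ∑' z, dz ψ μ z * coProjBmW (toSite r) L (respStep (d := d) M N' μ z) l'' w')
      = axProjBmAt (toSite r) L (contourSum M (fun κ x => ∑' y₀, ψ y₀ * HcolSum (N := N') (Tex y₀) (cex y₀) κ x)) := by
    funext l'' w'
    rw [sum_tsum_mul_coProjBmW (toSite r) L (fun μ => KKTFluctuationEnergy.summable_dz hψ μ) hC, axProjBmAt_eq_coProjBmW hL hr]
    congr 1
    funext κ u
    exact sum_tsum_dz_mul_respStep_eq hψ M κ u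
  rw [e, h]

end Step

/-! ## §5 The instance of record: the dressed one-step leg of the (E) recursion in units, `colH (coDressKBmAt ρ Lc K̃_m) Lc` -/

section Units

variable {Lc : ℕ} [NeZero Lc]

/-- [folklore] **THE DRESSED ONE-STEP LEG OF THE (E) RECURSION IN UNITS IS THE WINDOW-DRESSED `respStep` LEG**:
`colH (coDressKBmAt ρ Lc K̃_m) Lc μ z = coProjBmW ρ Lc (respStep (Lc^m) (Lc^(m+1)) μ z)` (`K̃_m = KStepUnit Lc m`; an2's `colH_coDressKBmAt_eq` and
leaf-12's `RespStepSemigroup.colH_KStepUnit` — the units `(Lc^m)^{d+2}` cancel an2's `respStep_eq` normalisation exactly). -/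
theorem colH_coDressKBmAt_KStepUnit (ρ : Fin (d + 1) → ℤ) (m : ℕ) (μ : Fin (d + 1)) (z : Site (d + 1)) :
    colH (coDressKBmAt ρ Lc (KStepUnit (d := d) Lc m)) Lc μ z = coProjBmW ρ Lc (respStep (d := d) (Lc ^ m) (Lc ^ (m + 1)) μ z) := by
  rw [colH_coDressKBmAt_eq, colH_KStepUnit]

/-- [folklore] … and, for an in-block root, IS THE PROJECTOR applied to the `respStep` leg: `colH (coDressKBmAt ρ Lc K̃_m) Lc μ z = Π^ρ_bm (respStep (Lc^m) (Lc^(m+1)) μ z)`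
— SKELETON-SREC 1.2's `T_m := Π_m ∘ 𝒬_{Lc^m} ℋ_{Lc^{m+1}}` as a kernel identity. -/
theorem colH_coDressKBmAt_KStepUnit_eq_axProjBmAt {r : Fin (d + 1) → ℕ} (hr : r ∈ box (d + 1) Lc) (m : ℕ) (μ : Fin (d + 1))
    (z : Site (d + 1)) :
    colH (coDressKBmAt (toSite r) Lc (KStepUnit (d := d) Lc m)) Lc μ z
      = axProjBmAt (toSite r) Lc (respStep (d := d) (Lc ^ m) (Lc ^ (m + 1)) μ z) := by
  rw [colH_coDressKBmAt_KStepUnit, ← axProjBmAt_eq_coProjBmW' (Nat.one_le_iff_ne_zero.2 (NeZero.ne Lc)) hr]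

/-- [folklore] **SR-L4a INDUCTION-STEP INPUT (row V4-b)**: for every in-block root, every level `m` and every SUMMABLE `ψ`, the dressed one-step leg of the
(E) recursion maps the exact coarse datum `d_c ψ` to an inter-block pure gauge — `∃ ψ′` BLOCK-CONSTANT on the `Lc`-blocks with
`(l″, w′) ↦ Σ_μ Σ'_z (dz ψ)(μ, z) · colH (coDressKBmAt ρ Lc K̃_m) Lc μ z l″ w′ = dz ψ′`. -/
theorem dressedLeg_KStepUnit_exact {r : Fin (d + 1) → ℕ} (hr : r ∈ box (d + 1) Lc) (m : ℕ) {ψ : Site (d + 1) → ℝ} (hψ : Summable ψ) :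
    ∃ ψ' : Form0 (d + 1) ℝ, (∀ x, ψ' x = ψ' ((Lc : ℤ) • blk Lc x)) ∧
      (fun l'' w' => ∑ μ, ∑' z, dz ψ μ z * colH (coDressKBmAt (toSite r) Lc (KStepUnit (d := d) Lc m)) Lc μ z l'' w') = dz ψ' := by
  simp only [colH_coDressKBmAt_KStepUnit]
  exact dressedStep_exact (Nat.one_le_iff_ne_zero.2 (NeZero.ne Lc)) hr (Lc ^ m) hψ

end Units

end Summit.QuantumFields.BalabanUV.Beta.GAN24.RespStepBmGaugeStep

end
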